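import Summits.BirchSwinnertonDyer.BirchSwinnertonDyer.Theorems.ManinLocalTwoThreeKatoFactTwoAtOddIsogeny
import Summits.BirchSwinnertonDyer.Rank1Residual.ManinAdditive.ShimuraLedger
import Literature.NumberTheory.EllipticCurves.IsogenyIdProofs
import HarnessLib
import HarnessLib.Audit.Tags

/-!
# THE HALF-HOMOTHETY AND ODD-NEIGHBOUR LOCI OF THE Γ₁ KATO ROAD — vocabulary `HalfHomothety` / `TwoPowerHomothety` / `CuspidalIndexTwo` /
# `OddIsogenous` / `OddSymbolClosureNeighbour`, the LAW E-es-123 `HalfHomothetyOnTotallyBlind`, the support node S-es-g26-1, and the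
# by-name edges to the provers' theorems (cell `bsd-f2-manin`, planner `es` g26, MEMO-es §40.12–40.13; T-es-39; nothing asserted)

TYPER NOTE (typer g18, T-es-39).  SOURCES = HOME/es/g26/Sketch-es-g26b.lean sha16 16f57e3c5eccf32c §A/§C/§D and Sketch-es-g26c.lean sha16
e521510fb324838e (both farm rc 0 · 0 err · 0 warn · 0 sorry per es; BC7 Probe-es-g26b 5/5 CLEAN, Probe-es-g26c 2/2 CLEAN), namespace `BsdF2ManinEsG26`
folded to `…ManinAdditive.KatoCurve` (the namespace of E-es-110/111/112/122).  WHAT IS VERBATIM (plus six one-line typer docstrings for the gate's docstring lint): §A (`symbolClosure`, `HalfHomothety`,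
`TwoPowerHomothety`, `twoPowerHomothety_of_half`), §C (`katoFactTwoAt_of_twoPowerHomothety`, `not_two_dvd_maninConstant_of_twoPowerHomothety[_of_four_dvd]`),
§D (`CuspidalIndexTwo`, LAW **E-es-123 `HalfHomothetyOnTotallyBlind`** (`@[conjecture]`, nothing asserted), `gammaOneOdd_on_cuspidalIndexTwo_blindClasses`,
`GammaOneOddOnCuspidalIndexTwoBlindClasses` + `_of`, restricted stub `KatoNeronIntegralTwoGamma1OptimalOnTwoPowerHomothety` + `_of` / `_of_stub`),
and all of g26c (`OddIsogenous`, `oddIsogenous_self`, support **S-es-g26-1 `KatoFactTwoAtOddIsogenyTransfer`** (plain node), `OddSymbolClosureNeighbour`,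
`oddSymbolClosureNeighbour_of_isSymbolClosureCurve`, `katoFactTwoAt_of_oddSymbolClosureNeighbour`, `not_two_dvd_maninConstant_of_oddSymbolClosureNeighbour_of_four_dvd`,
restricted stub `KatoNeronIntegralTwoGamma1OptimalOnOddNeighbour` + `_of`).  WHAT IS RE-ROUTED BY NAME (dedup: the provers landed es's §B and
S-es-g26-1-at-`4 ∣ N` BY VALUE with the locus bodies spelled out — p3 p699401 `Theorems/ManinLocalTwoThreeKatoFactTwoAtOddIsogeny.lean`, p1 p702216):
§B `isSymbolClosureCurve_of_twoPowerHomothety` is the one-liner over p3's `isSymbolClosureCurve_of_isOptimal_of_twoPow` (es's 30-line proof and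
its helper `c_ne_zero_of_isOptimal` are not re-landed), and two typer edges close the `4 ∣ N` instances of the support node from p3's theorems:
`katoFactTwoAt_of_oddIsogenous_of_four_dvd` (S-es-g26-1 at `4 ∣ N` = p3's `katoFactTwoAt_of_oddIsogeny`) and
`not_two_dvd_maninConstant_of_oddSymbolClosureNeighbour_of_four_dvd'` (no `hT` hypothesis; = p3's `not_two_dvd_maninConstant₁_of_oddIsogeny_symbolClosure`).
The unrestricted node S-es-g26-1 stays OPEN by name (es: «routine»; the tree proves it at `4 ∣ N`, which is where every C2 consumer lives).
All imports are free of Theses/Cruxes modules (transitive check) — the leaf is ROUTE-INDEPENDENT.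

HONEST FRAMING.  LENS: es.  E-es-123 is an f-INTRINSIC lattice LAW («an's territory in lattice clothing», es): on an's totally-blind family the
cuspidal group `ψ(C₀) ≅ ℤ/2` forces `𝓛̄_f = ½Λ₁(f)`; paper proof from E-es-50 (blind T cuspidal) + `θ = ±ψ̂_T` (E-an-54/66): `𝓛̄_f/Λ₁ = θ⁻¹(ker θ̂) =
ker[2]`; ref1 §R133: «A-es-g26-2 (ker θ̂ = ⟨T⟩) is AUTOMATIC once s = 2; the load-bearing content of E-es-123 is the gain law “totally blind ∧
|ψ(C₀)| = 2 ⟹ s = 2”»; E-es-123 SURVIVES as LAW; R-es-58 (i) PASS by the tree, (iv) sign VERIFIED.  NOT IN PRINT: the statement that turns the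
printed fact F-es-21♭K (Kato's explicit reciprocity read at the symbol-closure curve) into stub 6′ on the whole totally-blind family; searches as
MEMO-es §40.9 + `lean search isSymbolClosureCurve_of` (none before p3).  NEAREST PRINT BY NAME: [Kato2004Asterisque (8.1.3), Thm 12.5 (1)],
[Wuthrich2014 §3], [Stevens1989 §2].  WHY NOVEL (es): one f-intrinsic lattice statement replaces the image hypothesis on an's whole family.
BC5 WITNESS: census E41 (= HOME/es/g26/E40-REALCUSP2CLASS-v1.tsv 606cb65c77a4c493, column Phi1_structure): `𝓛̄_f/Λ₁(f) = E₁[2]`, i.e. HalfHomothety,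
on 17/21 totally-blind classes `4 ∣ N ≤ 5000` (all with `ψ(C₀) ≅ ℤ/2`; 13/17 independently by E30/E31 «E_K = E_min»); off-locus: 20a1, 80b1
(`ψ(C₀) ≅ ℤ/6`: half-homothetic up to the 3-isogeny — the odd-neighbour locus), 40a1 (`𝓛̄/Λ₁ ≅ ℤ/4 × ℤ/2`), 32a1 (order 16, CM) — meets 17,
beyond-print 17, violations 0.  CHEAPEST FALSIFIER (run): a row of E41 meeting the binders with Phi1_structure ≠ E₁[2] — 0/17; next: D-es-g26-2
(Smith form of `𝓛̄_f/Λ₁(f)` on the 21 + 89 totally-blind classes ≤ 5·10⁵, two engines).  REFUTER VERDICTS: ref1 §R133 E-es-123 SURVIVES (LAW),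
S-es-g26-1 PROVED at `4 ∣ N`, restricted assemblies VALID, KILLED 0; ref2 PENDING.  PARTITION currency (es §40.14): C2¹ = HH part (17/21 ⟸
F-es-21♭K ∧ E-es-123, assembly proved) ⊔ HH-up-to-odd (2/21 ⟸ F-es-21♭K ∧ E-es-123♯ ∧ S-es-g26-1) ⊔ real non-HH (40a1-type ⟸ E-es-122) ⊔ non-real
(32a1-type, open); no RES class moves (nothing here is in the route's partition); beyond-print theorem: NO; bears_on: stmt-BirchSwinnertonDyer-22967
(C2) — the LEAD's v16/v17 recut of stub 6′ reads these loci.  BSD is not proved by this; Manin's conjecture is not proved; C2/C3 OPEN.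
[cite: Kato2004Asterisque, (8.1.2)–(8.1.3) (p. 180) and Thm. 12.5 (1) (p. 221) (the explicit reciprocity law at p = 2 read at the symbol-closure curve = F-es-21♭K; shape only — E-es-123 is the cell's LAW, MEMO-es §40.12, NOT in print)]
[cite: Wuthrich2014, §1 and §3 (the lattice of all modular symbols and the integrality of Kato's classes; nearest print)]
[cite: Stevens1989, §2 (Stevens' curve, c₁; shape only)] [cite: SilvermanAEC2009, III.4 and III.6 (isogenies and their degrees; shape only)]
-/

noncomputable section

open scoped Classical MatrixGroups ModularForm ComplexConjugate
open CongruenceSubgroup Complex WeierstrassCurve Literature.NumberTheory.EllipticCurves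
open Literature.NumberTheory.EllipticCurves.ModularForms
open Summit.BirchSwinnertonDyer.Rank1Residual.ManinAdditive
open Summit.BirchSwinnertonDyer.Rank1Residual.ManinAdditive.KatoCurve
open Summit.BirchSwinnertonDyer.BirchSwinnertonDyer.Theorems.ManinLocalTwoThree
open Summit.BirchSwinnertonDyer.BirchSwinnertonDyer.Theorems.ManinLocalTwoThree.GammaOneKatoRoad

namespace Summit.BirchSwinnertonDyer.Rank1Residual.ManinAdditive.KatoCurve

variable {N : ℕ}

/-! ## §A The locus: `𝓛̄_f = 2^{-j} Λ₁(f)` -/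

/-- The SYMBOL CLOSURE `𝓛̄_f`: the subgroup of `ℂ` generated by all modular symbols `{∞, r}_f`, `r ∈ ℚ`
(Kato's lattice: `ℂ/𝓛̄_f` carries `V_ℤ₂(f)(1)`; MEMO-es §28). -/
abbrev symbolClosure (f : CuspForm (Gamma0 N) 2) : AddSubgroup ℂ :=
  AddSubgroup.closure (Set.range (modularSymbol f))

/-- **`HalfHomothety f`**: `𝓛̄_f = ½ · Λ₁(f)` — a modular symbol lies in the symbol closure iff its double is a
`Γ₁(N)`-period.  Equivalently `𝓛̄_f/Λ₁(f) = (ℂ/Λ₁(f))[2]`: the images of ALL cusps of `X₁(N)` in Stevens' curve are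
exactly its 2-torsion.  (A predicate on `f`; decidable per `f` by one modular-symbol computation.) -/
def HalfHomothety (f : CuspForm (Gamma0 N) 2) : Prop :=
  ∀ z : ℂ, z ∈ symbolClosure f ↔ 2 * z ∈ periodLatticeGamma1 f

/-- **`TwoPowerHomothety f`**: `𝓛̄_f = 2^{-j} · Λ₁(f)` for some `j : ℕ`. -/
def TwoPowerHomothety (f : CuspForm (Gamma0 N) 2) : Prop :=
  ∃ j : ℕ, ∀ z : ℂ, z ∈ symbolClosure f ↔ (2 : ℂ) ^ j * z ∈ periodLatticeGamma1 f

/-- `HalfHomothety ⟹ TwoPowerHomothety` (`j = 1`). -/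
theorem twoPowerHomothety_of_half {f : CuspForm (Gamma0 N) 2} (h : HalfHomothety f) :
    TwoPowerHomothety f :=
  ⟨1, fun z => by rw [pow_one]; exact h z⟩

/-! ## §B An `X₁(N)`-optimal curve on the locus IS a symbol-closure curve — BY NAME over p3's by-value theorem -/

/-- **THE OBSERVATION** (es g26b §B): if `𝓛̄_f = 2^{-j} Λ₁(f)` and `Λ_V = c₁ Λ₁(f)` (optimality), then `V` is a symbol-closure curve for `f`
(`IsSymbolClosureCurve`, the hypothesis of F-es-21♭K).  es's 30-line proof was landed by value by p3 as
`isSymbolClosureCurve_of_isOptimal_of_twoPow` (p699401, the locus body spelled out); this is the by-name form. -/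
theorem isSymbolClosureCurve_of_twoPowerHomothety {V : WeierstrassCurve ℚ} [NeZero N]
    (D₁ : Gamma1ParametrizationData V N) (hopt : D₁.IsOptimal) (hh : TwoPowerHomothety D₁.f) :
    IsSymbolClosureCurve V D₁.f := by
  obtain ⟨j, hj⟩ := hh
  exact isSymbolClosureCurve_of_isOptimal_of_twoPow D₁ hopt j hj

/-! ## §C Stub 6′ on the locus = F-es-21♭K BY NAME; hence `2 ∤ c₁` there (PROVED modulo the Literature fact) -/

/-- **Stub 6′ (`KatoNeronIntegralTwoGamma1Optimal`) INSTANCE on the two-power-homothety locus, from F-es-21♭K by name.** -/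
theorem katoFactTwoAt_of_twoPowerHomothety (hK : kato_isIntegral_twistedSymbolSum_two_symbolClosure)
    (V : WeierstrassCurve ℚ) [V.IsElliptic] [V.IsGloballyMinimal] [NeZero N]
    (D₁ : Gamma1ParametrizationData V N) (hopt : D₁.IsOptimal) (hh : TwoPowerHomothety D₁.f) :
    KatoFactTwoAt V D₁.f :=
  hK V D₁.f (isSymbolClosureCurve_of_twoPowerHomothety D₁ hopt hh)

/-- **`2 ∤ c₁` on the locus** (F-es-21♭K + the tree THEOREMS `twoAdicGammaOneWitnessLaw_holds` (E-es-111) and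
`not_two_dvd_maninConstant₁_of_katoFact_of_witness` (the Γ₁ lever)). -/
theorem not_two_dvd_maninConstant_of_twoPowerHomothety
    (hK : kato_isIntegral_twistedSymbolSum_two_symbolClosure)
    (V : WeierstrassCurve ℚ) [V.IsElliptic] [V.IsGloballyMinimal] [NeZero N]
    (D₁ : Gamma1ParametrizationData V N) (hopt : D₁.IsOptimal) (hh : TwoPowerHomothety D₁.f)
    (hg : ¬ V.HasGoodReductionAtPrime 2) (hmu : ¬ V.HasMultiplicativeReductionAtPrime 2) :
    ¬ (2 : ℤ) ∣ D₁.maninConstant :=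
  not_two_dvd_maninConstant₁_of_katoFact_of_witness V D₁ hopt
    (katoFactTwoAt_of_twoPowerHomothety hK V D₁ hopt hh) hg hmu
    (twoAdicGammaOneWitnessLaw_holds V D₁ hopt hg hmu)

/-- Same with the additivity at `2` discharged by `4 ∣ N` (`additive_of_sq_dvd_level`). -/
theorem not_two_dvd_maninConstant_of_twoPowerHomothety_of_four_dvd
    (hK : kato_isIntegral_twistedSymbolSum_two_symbolClosure)
    (V : WeierstrassCurve ℚ) [V.IsElliptic] [V.IsGloballyMinimal] [NeZero N]
    (D₁ : Gamma1ParametrizationData V N) (hopt : D₁.IsOptimal) (hh : TwoPowerHomothety D₁.f)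
    (h4 : 2 ^ 2 ∣ N) : ¬ (2 : ℤ) ∣ D₁.maninConstant :=
  have h := additive_of_sq_dvd_level 2 V D₁.f D₁.isNewformOf h4
  not_two_dvd_maninConstant_of_twoPowerHomothety hK V D₁ hopt hh h.1 h.2

/-! ## §D The LAW E-es-123 (f-intrinsic; census 17/17) and the restricted C2¹ it buys -/

/-- `[𝓛̄_f : Λ_f] = 2` (the cuspidal group `ψ(C₀) ⊂ E₀` has order exactly two), elementary phrasing:
some symbol is not a `Γ₀(N)`-period, and any two symbols outside `Λ_f` differ by a period. -/
def CuspidalIndexTwo (f : CuspForm (Gamma0 N) 2) : Prop :=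
  (∃ w₀ ∈ symbolClosure f, w₀ ∉ periodLattice f) ∧
    ∀ w ∈ symbolClosure f, ∀ w' ∈ symbolClosure f,
      w ∈ periodLattice f ∨ w' ∈ periodLattice f ∨ w - w' ∈ periodLattice f

/-- **LAW E-es-123 `HalfHomothetyOnTotallyBlind`** (cell candidate, lens es; NOT in print; nothing asserted).
For an `X₀(N)`-optimal `W₀`, `4 ∣ N`, model `a₁ = a₃ = 0` with a rational 2-torsion point and ALL rational 2-torsion
blind, whose cuspidal group has order `2`: `𝓛̄_f = ½ Λ₁(f)`.  Paper proof (tree-adjacent): `𝓛̄_f/Λ_f = ⟨T⟩` with `T`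
the blind point (E-es-50), `Λ₁(f) ⊆ Λ_f` of index `2` with `θ = ψ̂_T : W₁ → W₀` (E-an-54/66, `2Λ_f ⊆ Λ₁(f)`), hence
`𝓛̄_f/Λ₁(f) = θ⁻¹(ker θ̂) = ker [2]`.  Census (BC5): 17/17 blind classes `4 ∣ N ≤ 5000` with `ψ(C₀) ≅ ℤ/2`
(E40 606cb65c77a4c493; 13 of them independently by the lattice identification `E_K = E_min`, E30/E31, MEMO-es §28.5).
Why it might fail: a blind class where `ker θ̂ ≠ ⟨T⟩` (needs a second rational 2-torsion point: then `𝓛̄_f/Λ₁(f) ≅ ℤ/4`). -/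
@[conjecture]
def HalfHomothetyOnTotallyBlind : Prop :=
  ∀ (W₀ : WeierstrassCurve ℚ) [W₀.IsElliptic] [W₀.IsGloballyMinimal] {N : ℕ} [NeZero N]
    (D₀ : ModularParametrizationData W₀ N),
    (∀ z ∈ D₀.L.lattice, ∃ w ∈ periodLattice D₀.f, z = D₀.c * w) →
    2 ^ 2 ∣ N → W₀.a₁ = 0 → W₀.a₃ = 0 → ShimuraLedger.HasRationalTwoTorsion W₀ →
    ShimuraLedger.AllRationalTwoTorsionBlind W₀ → CuspidalIndexTwo D₀.f → HalfHomothety D₀.f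

/-- **C2¹ `ShimuraLedger.GammaOneOddOnBlindClasses` RESTRICTED to `[𝓛̄_f : Λ_f] = 2`, from F-es-21♭K ∧ E-es-123 and
tree theorems only (kernel-checked assembly).** -/
theorem gammaOneOdd_on_cuspidalIndexTwo_blindClasses
    (hK : kato_isIntegral_twistedSymbolSum_two_symbolClosure) (h123 : HalfHomothetyOnTotallyBlind)
    (W₁ W₀ : WeierstrassCurve ℚ) [W₁.IsElliptic] [W₁.IsGloballyMinimal] [W₀.IsElliptic] [W₀.IsGloballyMinimal]
    [NeZero N] (D₁ : Gamma1ParametrizationData W₁ N) (D₀ : ModularParametrizationData W₀ N)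
    (hiso : IsIsogenous W₁ W₀) (hopt : D₁.IsOptimal)
    (hopt₀ : ∀ z ∈ D₀.L.lattice, ∃ w ∈ periodLattice D₀.f, z = D₀.c * w)
    (h4 : 2 ^ 2 ∣ N) (ha₁ : W₀.a₁ = 0) (ha₃ : W₀.a₃ = 0) (hT : ShimuraLedger.HasRationalTwoTorsion W₀)
    (hbl : ShimuraLedger.AllRationalTwoTorsionBlind W₀) (hC : CuspidalIndexTwo D₀.f) :
    ¬ (2 : ℤ) ∣ D₁.maninConstant := by
  have hf : D₁.f = D₀.f := D₁.isNewformOf.unique (D₀.isNewformOf.of_isIsogenous hiso)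
  have hh : HalfHomothety D₁.f := by
    rw [hf]; exact h123 W₀ D₀ hopt₀ h4 ha₁ ha₃ hT hbl hC
  exact not_two_dvd_maninConstant_of_twoPowerHomothety_of_four_dvd hK W₁ D₁ hopt
    (twoPowerHomothety_of_half hh) h4

/-- The restricted C2¹ as a closed `Prop` (for the probe): `GammaOneOddOnBlindClasses` with the one extra binder
`CuspidalIndexTwo D₀.f`. -/
def GammaOneOddOnCuspidalIndexTwoBlindClasses : Prop :=
  ∀ (W₁ W₀ : WeierstrassCurve ℚ) [W₁.IsElliptic] [W₁.IsGloballyMinimal] [W₀.IsElliptic] [W₀.IsGloballyMinimal]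
    {N : ℕ} [NeZero N] (D₁ : Gamma1ParametrizationData W₁ N) (D₀ : ModularParametrizationData W₀ N),
    IsIsogenous W₁ W₀ → D₁.IsOptimal → (∀ z ∈ D₀.L.lattice, ∃ w ∈ periodLattice D₀.f, z = D₀.c * w) →
    2 ^ 2 ∣ N → W₀.a₁ = 0 → W₀.a₃ = 0 → ShimuraLedger.HasRationalTwoTorsion W₀ →
    ShimuraLedger.AllRationalTwoTorsionBlind W₀ → CuspidalIndexTwo D₀.f → ¬ (2 : ℤ) ∣ D₁.maninConstant

/-- F-es-21♭K ∧ E-es-123 ⟹ the restricted C2¹ (closed form of the previous theorem). -/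
theorem gammaOneOddOnCuspidalIndexTwoBlindClasses_of
    (hK : kato_isIntegral_twistedSymbolSum_two_symbolClosure) (h123 : HalfHomothetyOnTotallyBlind) :
    GammaOneOddOnCuspidalIndexTwoBlindClasses :=
  fun W₁ W₀ _ _ _ _ _ _ D₁ D₀ hiso hopt hopt₀ h4 ha₁ ha₃ hT hbl hC =>
    gammaOneOdd_on_cuspidalIndexTwo_blindClasses hK h123 W₁ W₀ D₁ D₀ hiso hopt hopt₀ h4 ha₁ ha₃ hT hbl hC

/-- **Stub 6′ restricted to the locus, as a closed `Prop`** (the recut proposed to the LEAD): E-es-110 with the extra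
binder `TwoPowerHomothety D₁.f`; PROVED from F-es-21♭K. -/
def KatoNeronIntegralTwoGamma1OptimalOnTwoPowerHomothety : Prop :=
  ∀ (V : WeierstrassCurve ℚ) [V.IsElliptic] [V.IsGloballyMinimal] {N : ℕ} [NeZero N]
    (D₁ : Gamma1ParametrizationData V N), D₁.IsOptimal → TwoPowerHomothety D₁.f → KatoFactTwoAt V D₁.f

/-- F-es-21♭K ⟹ the restricted stub 6′ on the two-power-homothety locus. -/
theorem katoNeronIntegralTwoGamma1OptimalOnTwoPowerHomothety_of
    (hK : kato_isIntegral_twistedSymbolSum_two_symbolClosure) :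
    KatoNeronIntegralTwoGamma1OptimalOnTwoPowerHomothety :=
  fun V _ _ _ _ D₁ hopt hh => katoFactTwoAt_of_twoPowerHomothety hK V D₁ hopt hh

/-- Conversely the full stub 6′ trivially gives the restricted one (bookkeeping). -/
theorem katoNeronIntegralTwoGamma1OptimalOnTwoPowerHomothety_of_stub
    (h : KatoNeronIntegralTwoGamma1Optimal) : KatoNeronIntegralTwoGamma1OptimalOnTwoPowerHomothety :=
  fun V _ _ _ _ D₁ hopt _ => h V D₁ hopt


/-! ## §E (es g26c) The odd-neighbour locus and the support node S-es-g26-1 -/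

/-- `V'` and `V` are isogenous over `ℚ` by an isogeny of ODD degree. -/
def OddIsogenous (V' V : WeierstrassCurve ℚ) : Prop :=
  ∃ ψ : Isogeny V' V, Odd ψ.degree

/-- `OddIsogenous` is reflexive (`Isogeny.id`, degree `1`). -/
theorem oddIsogenous_self (V : WeierstrassCurve ℚ) : OddIsogenous V V :=
  ⟨Isogeny.id V, by rw [Isogeny.degree_id]; exact odd_one⟩

/-- **SUPPORT S-es-g26-1 `KatoFactTwoAtOddIsogenyTransfer`** (routine, not a law): Kato–Néron integrality at `2`
(`KatoFactTwoAt · f`) passes along an odd-degree `ℚ`-isogeny of globally minimal curves.  Proof sketch: with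
`ψ : V' → V` of odd degree `d`, the Néron scalars `k, k̂ ∈ ℤ` satisfy `k k̂ = d` (odd), `V(ℝ) = d·V(ℝ) ⊆ ψ V'(ℝ)`,
`#(ker ψ ∩ V'(ℝ)) ∣ d`; hence `Ω(V) = (odd/odd)·Ω(V')`, so `ϖ_V = (odd/odd)·ϖ_{V'}` and the odd cofactor `s`
absorbs the change; `IsNewformOf`, `¬good₂`, `¬mult₂` are isogeny invariants. -/
def KatoFactTwoAtOddIsogenyTransfer : Prop :=
  ∀ (V V' : WeierstrassCurve ℚ) [V.IsElliptic] [V.IsGloballyMinimal] [V'.IsElliptic] [V'.IsGloballyMinimal]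
    {N : ℕ} [NeZero N] (f : CuspForm (Gamma0 N) 2),
    OddIsogenous V' V → KatoFactTwoAt V' f → KatoFactTwoAt V f

/-- **The locus**: `V` has an odd-isogenous globally minimal neighbour which is a symbol-closure curve for `f`. -/
def OddSymbolClosureNeighbour (V : WeierstrassCurve ℚ) (f : CuspForm (Gamma0 N) 2) : Prop :=
  ∃ V' : WeierstrassCurve ℚ, V'.IsElliptic ∧ V'.IsGloballyMinimal ∧ OddIsogenous V' V ∧ IsSymbolClosureCurve V' f

/-- A symbol-closure curve is its own odd symbol-closure neighbour. -/
theorem oddSymbolClosureNeighbour_of_isSymbolClosureCurve (V : WeierstrassCurve ℚ) [hE : V.IsElliptic]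
    [hM : V.IsGloballyMinimal] (f : CuspForm (Gamma0 N) 2) (h : IsSymbolClosureCurve V f) :
    OddSymbolClosureNeighbour V f :=
  ⟨V, hE, hM, oddIsogenous_self V, h⟩

/-- Stub 6′ instance on the odd-neighbour locus, from F-es-21♭K + S-es-g26-1. -/
theorem katoFactTwoAt_of_oddSymbolClosureNeighbour
    (hK : kato_isIntegral_twistedSymbolSum_two_symbolClosure) (hT : KatoFactTwoAtOddIsogenyTransfer)
    (V : WeierstrassCurve ℚ) [V.IsElliptic] [V.IsGloballyMinimal] [NeZero N]
    (f : CuspForm (Gamma0 N) 2) (h : OddSymbolClosureNeighbour V f) : KatoFactTwoAt V f := by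
  obtain ⟨V', hE, hM, hodd, hsc⟩ := h
  haveI := hE; haveI := hM
  exact hT V V' f hodd (hK V' f hsc)

/-- `2 ∤ c₁` on the odd-neighbour locus at `4 ∣ N` (F-es-21♭K + S-es-g26-1 + tree theorems). -/
theorem not_two_dvd_maninConstant_of_oddSymbolClosureNeighbour_of_four_dvd
    (hK : kato_isIntegral_twistedSymbolSum_two_symbolClosure) (hT : KatoFactTwoAtOddIsogenyTransfer)
    (V : WeierstrassCurve ℚ) [V.IsElliptic] [V.IsGloballyMinimal] [NeZero N]
    (D₁ : Gamma1ParametrizationData V N) (hopt : D₁.IsOptimal) (h : OddSymbolClosureNeighbour V D₁.f)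
    (h4 : 2 ^ 2 ∣ N) : ¬ (2 : ℤ) ∣ D₁.maninConstant :=
  have ha := additive_of_sq_dvd_level 2 V D₁.f D₁.isNewformOf h4
  not_two_dvd_maninConstant₁_of_katoFact_of_witness V D₁ hopt
    (katoFactTwoAt_of_oddSymbolClosureNeighbour hK hT V D₁.f h) ha.1 ha.2
    (twoAdicGammaOneWitnessLaw_holds V D₁ hopt ha.1 ha.2)

/-- Restricted stub 6′ on the odd-neighbour locus as a closed `Prop` (for the LEAD's recut 6′a ∪ 6′c). -/
def KatoNeronIntegralTwoGamma1OptimalOnOddNeighbour : Prop :=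
  ∀ (V : WeierstrassCurve ℚ) [V.IsElliptic] [V.IsGloballyMinimal] {N : ℕ} [NeZero N]
    (D₁ : Gamma1ParametrizationData V N), D₁.IsOptimal → OddSymbolClosureNeighbour V D₁.f → KatoFactTwoAt V D₁.f

/-- F-es-21♭K ∧ S-es-g26-1 ⟹ the restricted stub 6′ on the odd-neighbour locus. -/
theorem katoNeronIntegralTwoGamma1OptimalOnOddNeighbour_of
    (hK : kato_isIntegral_twistedSymbolSum_two_symbolClosure) (hT : KatoFactTwoAtOddIsogenyTransfer) :
    KatoNeronIntegralTwoGamma1OptimalOnOddNeighbour :=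
  fun V _ _ _ _ D₁ _ h => katoFactTwoAt_of_oddSymbolClosureNeighbour hK hT V D₁.f h

/-! ## §F Typer edges: the `4 ∣ N` instances of S-es-g26-1 are p3's theorems (p699401) BY NAME -/

/-- **S-es-g26-1 at `4 ∣ N` is a THEOREM** (p3 `katoFactTwoAt_of_oddIsogeny`, p699401): Kato–Néron integrality at `2` passes along an
odd-degree isogeny of globally minimal curves at every level `4 ∣ N` (the binder stands in for the isogeny-invariance of additivity at `2`).
The unrestricted node `KatoFactTwoAtOddIsogenyTransfer` stays open by name; every C2 consumer lives at `4 ∣ N`. -/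
theorem katoFactTwoAt_of_oddIsogenous_of_four_dvd (V V' : WeierstrassCurve ℚ) [V.IsElliptic] [V.IsGloballyMinimal]
    [V'.IsElliptic] [V'.IsGloballyMinimal] [NeZero N] (f : CuspForm (Gamma0 N) 2) (h4 : 2 ^ 2 ∣ N)
    (h : OddIsogenous V' V) (hK' : KatoFactTwoAt V' f) : KatoFactTwoAt V f := by
  obtain ⟨ψ, hodd⟩ := h
  exact katoFactTwoAt_of_oddIsogeny V V' f h4 ψ hodd hK'

/-- **`2 ∤ c₁` on the odd-neighbour locus at `4 ∣ N`, modulo F-es-21♭K ALONE** (no `hT`: p3's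
`not_two_dvd_maninConstant₁_of_oddIsogeny_symbolClosure` by name). -/
theorem not_two_dvd_maninConstant_of_oddSymbolClosureNeighbour_of_four_dvd'
    (hK : kato_isIntegral_twistedSymbolSum_two_symbolClosure)
    (V : WeierstrassCurve ℚ) [V.IsElliptic] [V.IsGloballyMinimal] [NeZero N]
    (D₁ : Gamma1ParametrizationData V N) (hopt : D₁.IsOptimal) (h : OddSymbolClosureNeighbour V D₁.f)
    (h4 : 2 ^ 2 ∣ N) : ¬ (2 : ℤ) ∣ D₁.maninConstant := by
  obtain ⟨V', hE, hM, ⟨ψ, hodd⟩, hsc⟩ := h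
  haveI := hE; haveI := hM
  exact not_two_dvd_maninConstant₁_of_oddIsogeny_symbolClosure hK V V' D₁ hopt ψ hodd hsc h4

/-- The restricted stub 6′ on the odd-neighbour locus AT `4 ∣ N`, closed modulo F-es-21♭K alone (typer edge over p3). -/
theorem katoFactTwoAt_of_oddSymbolClosureNeighbour_of_four_dvd
    (hK : kato_isIntegral_twistedSymbolSum_two_symbolClosure)
    (V : WeierstrassCurve ℚ) [V.IsElliptic] [V.IsGloballyMinimal] [NeZero N]
    (f : CuspForm (Gamma0 N) 2) (h4 : 2 ^ 2 ∣ N) (h : OddSymbolClosureNeighbour V f) : KatoFactTwoAt V f := by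
  obtain ⟨V', hE, hM, ⟨ψ, hodd⟩, hsc⟩ := h
  haveI := hE; haveI := hM
  exact katoFactTwoAt_of_oddIsogeny_of_isSymbolClosureCurve hK V V' f h4 ψ hodd hsc

end Summit.BirchSwinnertonDyer.Rank1Residual.ManinAdditive.KatoCurve

end
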